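import Summits.ResolutionOfSingularities.ResolutionOfSingularities.Theorems.MarkedTransferCampaignW36SingularLCISlices
import Summits.ResolutionOfSingularities.ResolutionOfSingularities.Theorems.MarkedTransferCampaignW36SingularLCIInhabitantReadings
import Literature.AlgebraicGeometry.Hironaka2017.Proofs.S04CharAlgebra.CotVecRank
import Literature.AlgebraicGeometry.Hironaka2017.S15ARSchemes.R017YOfE
import HarnessLib

/-!
# [OURS · L1 W3.6 ↔ GAP-LEDGER R20 sub 20a ∧ 20b(ii), G5 cell (c1)] AT SEAT 1's CERTIFIED CROSS THE RANK OF THE COTANGENT VECTOR SPACE `𝔳̄(Ě)_ξ` JUMPS ALONG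
# `Sing(Ě)_cl` — `¬ S15ARSchemes.U75L37 Ě (cotVecAt_ours Ě · 2)` for EVERY typed core focus `Ě` of `Ê_×` (res-adj-3 F5b rider (c1) / res-adj-5 G5 severity column)

Cell `res-hironaka`, rung L (rescue), row L-G3 ↔ G5, slot W3.6 ↔ GAP-LEDGER R20. Typed by the OURS typer o4 (statement-only lane); kernel plumbing only (0 definitions),
the OPTIONAL rider (c1) of res-adj-3's ASK F5b (INBOX 2026-08-27T08:17:35Z: «`¬ S15ARSchemes.U75L37 Ě v̄` at the member with `v̄ := cotVecAt_ours` (`r = 1` at the cross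
point p504767 vs `r = 2` at branch points p506409 + `finrank_cotVecAt_ours_eq_r` p491148)»), companion of p513930 `…W36SingularLCISlices`. HOST:
`--supports stmt-ResolutionOfSingularities-16155 --as helper`.

INPUTS BY NAME. SEAT 1 (res-D-pv-034 AS res-L1-s36-pv-3): `CrossSpecimen.exists_isEdgeData_cross` (an R1 datum with `r = 1` at the origin, p504767
`CrossSpecimenStalks`), `CrossSpecimen.exists_isEdgeData_branch` / `exists_closed_branch_point` / `mem_C_iff_of_eq_vanishingIdeal` (an R1 datum with `r = 2` at a closed
branch point `(0, b, 0)`, `b ≠ 0`; p506409 `Thm614Part1CrossNegative`), `CrossSpecimenEdge.closure_invmaxStratum_eq_C` (p511179), `CrossSpecimen.baseHike_EX` /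
`baseHike_b_pos` / `origin_mem_C`; res-D-pv-035 `S04CharAlgebra.finrank_cotVecAt_ours_eq_r` (p491148: `dim_κ(ξ) 𝔳̄(Ě)_ξ = D.r` for every R1 datum `D` on an ambient
scheme); `Lib/CoreFocusPAlg` (`sing_eq_closure_invmaxStratum_of_isCoreFocus`, `pAlg_eq_diffPower_sing_of_isCoreFocus`); row 017's typed CANDIDATE
`S15ARSchemes.U75L37` (p.75 L35–L37 «the rank m is constant at all points of Sing(Ě)_cl because Ě is core focused»), which enters ONLY as the negated conclusion.
* `CrossSpecimenW36.pAlg_eq_diffPower_C_of_isCoreFocus_inst` (plumbing; `Sing(Ě) = C` is p513766 `sing_eq_C_of_isCoreFocus`),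
  `CrossSpecimenW36.finrank_cotVecAt_origin_eq_one` / `exists_branch_finrank_cotVecAt_eq_two` — at every typed core focus `Ě` of `Ê_×`: rank `1` at the origin, rank `2`
  at some closed branch point of `Sing(Ě) = C`.
* **`CrossSpecimenW36.not_U75L37_cotVecAt_of_isCoreFocus_inst`** — for every certified family `ed` and every `Ě` with `IsCoreFocus_inst Ê_× Ě ed`:
  `¬ U75L37 Ě (fun ξ => cotVecAt_ours Ě ξ 2)`; **`exists_coreFocus_not_U75L37`** — such an `Ě` EXISTS (door), so the negative is inhabited.
HONEST FRAMING. Kernel plumbing over OUR typed carriers and SEAT 1's certified specimen; NOTHING here is a statement of H. Hironaka's manuscript (2017-03-23,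
[Hironaka2017], lit key `paper:url-3343fd9e678b`), which stays «under review»: `U75L37` is row 017's typed CANDIDATE of an unnumbered sentence, refuted here AS TYPED at
ONE located instance (reading `v̄ := cotVecAt_ours`, `p = 2`); whether the printed sentence intends this reading is the adjudicators' call (res-adj-5 (c1)). AI typing,
weaker than expert review.
Reference (context only, not a premise): H. Hironaka, ms. 2017-03-23, Def. 4.15 p.22; §6.2 Eq. (43) p.30; §15.1 p.75 L35–L37. [Hironaka2017]
-/

noncomputable section

set_option linter.dupNamespace false -- mandated namespace of this single-conjunct summit

open _root_.AlgebraicGeometry _root_.TopologicalSpace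
namespace Summit.ResolutionOfSingularities.ResolutionOfSingularities.Theorems

open Literature.AlgebraicGeometry.Resolution Literature.AlgebraicGeometry.Hironaka2017
open Literature.AlgebraicGeometry.Hironaka2017.S02Preliminaries Literature.AlgebraicGeometry.Hironaka2017.S04CharAlgebra
open Literature.AlgebraicGeometry.Hironaka2017.S06BaseHike Literature.AlgebraicGeometry.Hironaka2017.Datum
open Literature.AlgebraicGeometry.Hironaka2017.CoordArrangement
open Literature.AlgebraicGeometry.Hironaka2017.S06BaseHike.SpecimenA (Z ambient)
open Literature.AlgebraicGeometry.Hironaka2017.S06BaseHike.CrossSpecimen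
open Scheme.IdealSheafData IsLocalRing CampaignW36

namespace CrossSpecimenW36

variable (K : Type) [Field K] [CharP K 2] [IsAlgClosed K]

section CoreFocus

variable {K} {m : ℕ} (ed : EdgeDataOn 2 m (baseHike (EX K))) (hed : IsEdgeDataOn CampaignW31.edgeDataProvenance (baseHike (EX K)) ed)
  {Ec : IdealExponent (Z K)} (hEc : IsCoreFocus_inst (baseHike (EX K)) Ec ed)
include hed hEc

/-- At every typed core focus `Ě` of `Ê_×`: `℘(Ě, a) = 𝓘_C^{⟨a⟩}` for `a ≥ 1` (the hypothesis shape `hP` of SEAT 1's `CrossSpecimenStalks` / `Thm614Part1CrossNegative`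
sections). Kernel plumbing; NOT a statement of the manuscript. [folklore] -/
theorem pAlg_eq_diffPower_C_of_isCoreFocus_inst : ∀ a : ℕ, 0 < a → pAlg Ec a = diffPower (CrossSpecimen.C K) a := by
  have hcf : IsCoreFocus S04CharAlgebra.pAlg (invInst (baseHike (EX K)) ed) (baseHike (EX K)) Ec := hEc
  intro a ha
  rw [pAlg_eq_diffPower_sing_of_isCoreFocus (ambient K 2) _ _ (baseHike_b_pos K) hcf ha]
  congr 1
  exact Closeds.ext (sing_eq_C_of_isCoreFocus K 2 (invInst (baseHike (EX K)) ed) (baseHike (EX K)) Ec hEc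
    (closure_invmaxStratum_eq_C (baseHike_EX K) ed hed))

/-- **Rank `1` at the cross point**: `dim_κ 𝔳̄(Ě)_0 = 1` at the origin, for every typed core focus `Ě` of `Ê_×` (SEAT 1's `r = 1` datum + p491148). Kernel plumbing;
NOT a statement of the manuscript. [folklore] -/
theorem finrank_cotVecAt_origin_eq_one :
    Module.finrank (ResidueField ((Z K).presheaf.stalk (CoordChart.origin K (Fin 3))))
      (cotVecAt_ours Ec (CoordChart.origin K (Fin 3)) 2) = 1 := by
  obtain ⟨D₀, hD₀, hr₀⟩ := exists_isEdgeData_cross Ec (pAlg_eq_diffPower_C_of_isCoreFocus_inst ed hed hEc) 2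
  rw [finrank_cotVecAt_ours_eq_r (S16Proof.isAmbient_hom (ambient K 2)) Ec _ D₀ hD₀, hr₀]

/-- **Rank `2` at a closed branch point**: some closed `η ∈ Sing(Ě)` has `dim_κ 𝔳̄(Ě)_η = 2`, for every typed core focus `Ě` of `Ê_×` (SEAT 1's closed branch point
`(0, b, 0)`, `b ≠ 0`, and its `r = 2` datum + p491148). Kernel plumbing; NOT a statement of the manuscript. [folklore] -/
theorem exists_branch_finrank_cotVecAt_eq_two :
    ∃ η ∈ Ec.sing ∩ S02Preliminaries.closedPoints (Z K),
      Module.finrank (ResidueField ((Z K).presheaf.stalk η)) (cotVecAt_ours Ec η 2) = 2 := by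
  have hP := pAlg_eq_diffPower_C_of_isCoreFocus_inst ed hed hEc
  obtain ⟨η, v, -, hηcl, hv, hv0, hv2, hv1⟩ :=
    exists_closed_branch_point K 2 (V := (Set.univ : Set (Z K))) isOpen_univ (Set.mem_univ _)
  have hηsing : η ∈ Ec.sing := by
    rw [sing_eq_C_of_isCoreFocus K 2 (invInst (baseHike (EX K)) ed) (baseHike (EX K)) Ec hEc
      (closure_invmaxStratum_eq_C (baseHike_EX K) ed hed), mem_C_iff_of_eq_vanishingIdeal K hv]
    exact ⟨hv0, Or.inl hv2⟩
  obtain ⟨D₁, hD₁, hr₁⟩ := exists_isEdgeData_branch Ec hP hv hv1 2 hv0 hv2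
  exact ⟨η, ⟨hηsing, hηcl⟩, by rw [finrank_cotVecAt_ours_eq_r (S16Proof.isAmbient_hom (ambient K 2)) Ec _ D₁ hD₁, hr₁]⟩

/-- **`¬ U75L37` AT THE CROSS MEMBER (res-adj-5 G5 cell (c1), reading `v̄ := cotVecAt_ours`, `p = 2`)**: for every certified family `ed` of `Ê_×` and every `Ě` with
`IsCoreFocus_inst Ê_× Ě ed`, the typed sentence «`dim 𝔳̄(Ě)_ξ` is the same at all closed points of `Sing(Ě)`» FAILS — rank `1` at the cross point, `2` at a closed
branch point. Kernel refutation of a typed CANDIDATE at ONE located instance; NOT a statement of the manuscript. [folklore] -/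
theorem not_U75L37_cotVecAt_of_isCoreFocus_inst :
    ¬ S15ARSchemes.U75L37 (A := ambient K 2) Ec (fun ξ => cotVecAt_ours Ec ξ 2) := by
  intro hU
  obtain ⟨η, hη, hη2⟩ := exists_branch_finrank_cotVecAt_eq_two ed hed hEc
  have h0 : CoordChart.origin K (Fin 3) ∈ Ec.sing ∩ S02Preliminaries.closedPoints (Z K) :=
    ⟨by rw [sing_eq_C_of_isCoreFocus K 2 (invInst (baseHike (EX K)) ed) (baseHike (EX K)) Ec hEc
      (closure_invmaxStratum_eq_C (baseHike_EX K) ed hed)]; exact origin_mem_C K, CoordChart.isClosed_origin⟩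
  have h := hU _ h0 η hη
  rw [finrank_cotVecAt_origin_eq_one ed hed hEc, hη2] at h
  exact absurd h (by decide)

end CoreFocus

/-- **THE NEGATIVE IS INHABITED**: over every algebraically closed `K` of characteristic `2` there are a certified family `ed` of `Ê_×` (SEAT 1's
`exists_isEdgeDataOn_baseHike_EX`) and a typed core focus `Ě` (door, `exists_isCoreFocus_baseHike_EX`) with `¬ U75L37 Ě (cotVecAt_ours Ě · 2)`. Kernel plumbing; NOT a
statement of the manuscript. [folklore] -/
theorem exists_coreFocus_not_U75L37 :
    ∃ (ed : EdgeDataOn 2 3 (baseHike (EX K))) (Ec : IdealExponent (Z K)), IsCoreFocus_inst (baseHike (EX K)) Ec ed ∧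
      ¬ S15ARSchemes.U75L37 (A := ambient K 2) Ec (fun ξ => cotVecAt_ours Ec ξ 2) := by
  obtain ⟨ed, hed⟩ := exists_isEdgeDataOn_baseHike_EX K
  obtain ⟨Ec, hEc⟩ := exists_isCoreFocus_baseHike_EX K ed hed
  exact ⟨ed, Ec, hEc, not_U75L37_cotVecAt_of_isCoreFocus_inst ed hed hEc⟩

end CrossSpecimenW36

end Summit.ResolutionOfSingularities.ResolutionOfSingularities.Theorems

end
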